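import Literature.Analysis.FluidPDE.TorusNSGevreyCoefficients
import Literature.Analysis.FunctionSpaces.TorusFractionalSobolevEmbedding
import HarnessLib

/-!
# The convective term of a divergence-free field in divergence form on the lattice, and the
# Robinson–Sadowski–Silva trilinear estimate `|(B(u,u), Λ^{2s}u)| ≤ c ‖u‖_s ‖u‖_{s+1} ‖u‖_F`

Analysis/FluidPDE support file (theorems only; no definitions, no named facts).
Search for candidate a priori estimates; no regularity claim.

Robinson–Sadowski–Silva (J. Math. Phys. 53 (2012) 115618, §III) estimate the Navier–Stokes
nonlinearity on the torus against fractional powers of the Stokes operator through the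
`ℓ¹`-type norms `‖u‖_{F_r} = ∑_k |k|^r |û(k)|`:

  `|(B(u,u), A^s u)| ≤ c ‖u‖_s ‖u‖_{s+1} ‖u‖_F`        (3.5)

(`‖u‖_s² = ∑_k |k|^{2s}|û(k)|²`, `F = F_0`). The mechanism is that for divergence-free `u` the
convective term is a divergence, `(u·∇)v = ∇·(u ⊗ v)`, so that on the Fourier side the derivative
falls on the OUTPUT frequency: `𝓕((u·∇)v)(k) = 2πi ∑_m (k·û(m)) v̂(k−m)` (`m·û(m) = 0`), whence
`|𝓕((u·∇)v)(k)| ≲ |k| ∑_m |û(m)||v̂(k−m)|`; then `|k|^{2s+1} = |k|^{s+1}·|k|^s`,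
`|k|^s ≤ 2^s(|m|^s + |k−m|^s)` and Young's inequality for lattice convolutions
(`ℓ² · (ℓ² ∗ ℓ¹)`). Here, for smooth fields on the unit torus `T^n` (`n = card d`,
`|k|² = freqNormSq k`, `û = 𝓕(complexify ∘ u)`):

* `NSSobolev.norm_mFourierCoeff_convect_le_of_isDivFree` — for smooth divergence-free `u` and
  smooth `v`, `‖𝓕(complexify ∘ (u·∇)v)(k)‖ ≤ 2π n² |k| ∑_m ‖û(m)‖ ‖v̂(k−m)‖` (the tree's
  `NSGevrey.norm_mFourierCoeff_convect_le` has `|k−m|` inside the sum instead);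
* `NSSobolev.sum_rpow_mul_norm_mul_norm_convect_le` — **(3.5) on the lattice**: for smooth
  divergence-free `u`, `s ≥ 0` and every finite set `K` of frequencies,
  `∑_{k∈K} |k|^{2s} ‖û(k)‖ ‖𝓕((u·∇)u)(k)‖ ≤ 4π n² 2^s (∑_m ‖û(m)‖)(∑_m |m|^{2s}‖û(m)‖²)^{1/2}(∑_{k∈K} |k|^{2s+2}‖û(k)‖²)^{1/2}`,
  i.e. `≤ c ‖u‖_F ‖u‖_s ‖u‖_{s+1,K}` with the LAST factor truncated to `K` (as needed for
  differential inequalities of truncated Sobolev sums).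

Constants are explicit but not optimised.

## Mathlib / tree search

Tree (reused): the componentwise convolution identity inside `NSGevrey.norm_mFourierCoeff_convect_le`
(`TorusNSGevreyCoefficients`; re-derived here since only the bound is exported),
`NSGevrey.summable_convectMajorant`, `Torus.IsDivFree.sum_mul_mFourierCoeff_eq_zero`
(`k·û(k) = 0`, `TorusTrigPoly`), `NSGevrey.sum_mul_tsum_mul_le` (Young for lattice convolutions,
`TorusNSGevreyLattice`), `NSGevrey.sqrt_freqNormSq_add_le`,
`Torus.IsSmooth.summable_freqNormSq_rpow_mul_norm_sq` (`TorusFractionalSobolevEmbedding`).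
Searched `divergence form|div_form|convect.*isDivFree.*mFourierCoeff|trilinear.*rpow`: nothing
with the derivative on the output frequency.

## References

* J. C. Robinson, W. Sadowski, R. P. Silva, *Lower bounds on blow up solutions of the
  three-dimensional Navier–Stokes equations in homogeneous Sobolev spaces*, J. Math. Phys. 53
  (2012) 115618, §III (3.1)–(3.5) (held: paper:doi-10-1063-1-4762841, pp. 7–9).
  [RobinsonSadowskiSilva2012]
* C. Foias, R. Temam, *Gevrey class regularity for the solutions of the Navier–Stokes equations*,
  J. Funct. Anal. 87 (1989) 359–369, §2 (2.6) (the equation in Fourier variables). [FoiasTemam1989]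
-/

noncomputable section

open MeasureTheory Set Filter UnitAddTorus Function Finset
open scoped Topology BigOperators InnerProductSpace ComplexConjugate

namespace Literature.Analysis.FluidPDE

namespace NSSobolev

open Literature.Analysis.FunctionSpaces Literature.Analysis.FunctionSpaces.Torus NSGevrey
open ScalarFourier (lconv lconv_apply mFourierCoeff_mul)

variable {d : Type*} [Fintype d] [DecidableEq d]

variable {u v : UnitAddTorus d → EuclideanSpace ℝ d}

/-! ### §1 The convective term of a divergence-free field: the derivative on the output frequency -/

/-- Summability of the convolution majorant `m ↦ ‖û(m)‖ ‖v̂(k − m)‖` for smooth `u, v` (the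
coefficients of a smooth field are absolutely summable and bounded). The lattice sums of
Robinson–Sadowski–Silva §III. [cite: RobinsonSadowskiSilva2012, §III (3.2)–(3.3)] -/
theorem summable_norm_mul_norm_sub (hu : IsSmooth u) (hv : IsSmooth v) (k : d → ℤ) :
    Summable fun m : d → ℤ => ‖mFourierCoeff (EuclideanSpace.complexify ∘ u) m‖ *
      ‖mFourierCoeff (EuclideanSpace.complexify ∘ v) (k - m)‖ := by
  have hsV := (hv.complexify_comp.rapidDecay_mFourierCoeff).summable_norm
  have hsU := (hu.complexify_comp.rapidDecay_mFourierCoeff).summable_norm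
  refine (hsU.mul_right (∑' m, ‖mFourierCoeff (EuclideanSpace.complexify ∘ v) m‖)).of_nonneg_of_le
    (fun m => mul_nonneg (norm_nonneg _) (norm_nonneg _)) fun m =>
    mul_le_mul_of_nonneg_left (hsV.le_tsum (k - m) fun j _ => norm_nonneg _) (norm_nonneg _)

/-- **The convective term of a divergence-free field in divergence form** (Robinson–Sadowski–Silva
2012, §III, proof of (3.5); Foias–Temam 1989, (2.6)): for smooth real fields `u, v` on `T^n` with
`div u = 0` and every frequency `k`,
`‖𝓕(complexify ∘ (u·∇)v)(k)‖ ≤ 2π n² |k| ∑_m ‖û(m)‖ ‖v̂(k − m)‖`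
(`|k| = (freqNormSq k)^{1/2}`). Componentwise `𝓕((u·∇)v)_p(k) = ∑_m ∑_j û_j(m)(2πi(k−m)_j)v̂_p(k−m)`
and `∑_j m_j û_j(m) = 0` (`Torus.IsDivFree.sum_mul_mFourierCoeff_eq_zero`), so that
`∑_j (k−m)_j û_j(m) = ∑_j k_j û_j(m)`, bounded by `n |k| ‖û(m)‖`.
[cite: RobinsonSadowskiSilva2012, §III (3.5) (proof)] -/
theorem norm_mFourierCoeff_convect_le_of_isDivFree (hu : IsSmooth u) (hdiv : IsDivFree u)
    (hv : IsSmooth v) (k : d → ℤ) :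
    ‖mFourierCoeff (EuclideanSpace.complexify ∘ Torus.convect u v) k‖ ≤
      2 * Real.pi * (Fintype.card d : ℝ) ^ 2 * Real.sqrt (freqNormSq k) *
        ∑' m : d → ℤ, ‖mFourierCoeff (EuclideanSpace.complexify ∘ u) m‖ *
          ‖mFourierCoeff (EuclideanSpace.complexify ∘ v) (k - m)‖ := by
  classical
  set U : (d → ℤ) → EuclideanSpace ℂ d := fun m => mFourierCoeff (EuclideanSpace.complexify ∘ u) m
    with hU
  set V : (d → ℤ) → EuclideanSpace ℂ d := fun m => mFourierCoeff (EuclideanSpace.complexify ∘ v) m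
    with hV
  set T : ℝ := ∑' m : d → ℤ, ‖U m‖ * ‖V (k - m)‖ with hT
  have hTs : Summable fun m : d → ℤ => ‖U m‖ * ‖V (k - m)‖ := summable_norm_mul_norm_sub hu hv k
  have hT0 : 0 ≤ T := tsum_nonneg fun m => mul_nonneg (norm_nonneg _) (norm_nonneg _)
  have hMs : Summable fun m : d → ℤ => ‖U m‖ * (Real.sqrt (freqNormSq (k - m)) * ‖V (k - m)‖) :=
    summable_convectMajorant hu hv k
  have hcs : IsSmooth (Torus.convect u v) := hu.convect hv
  -- smooth complexified components
  have huj : ∀ j, IsSmooth (fun z => ((u z j : ℝ) : ℂ)) := fun j =>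
    (hu.apply j).comp_clm Complex.ofRealCLM
  have hvp : ∀ p, IsSmooth (fun z => ((v z p : ℝ) : ℂ)) := fun p =>
    (hv.apply p).comp_clm Complex.ofRealCLM
  -- the components of the convective term
  have hfun : ∀ p, (fun y => (EuclideanSpace.complexify ∘ Torus.convect u v) y p) =
      fun y => ∑ j, (fun z => ((u z j : ℝ) : ℂ)) y *
        Torus.partialDeriv j (fun z => ((v z p : ℝ) : ℂ)) y := by
    intro p
    funext y
    simp only [Function.comp_apply, EuclideanSpace.complexify_apply]
    rw [Torus.convect, fderiv_apply_eq_sum_partialDeriv (hv.isContDiff (by simp)) y (u y)]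
    simp only [WithLp.ofLp_sum, WithLp.ofLp_smul, Finset.sum_apply, Pi.smul_apply, smul_eq_mul]
    push_cast
    refine Finset.sum_congr rfl fun j _ => ?_
    rw [partialDeriv_ofReal_apply hv j p y, partialDeriv_apply_real hv j p y]
  -- componentwise identity `𝓕((u·∇)v)ₚ(k) = ∑ⱼ ∑ₘ Uⱼ(m) (2πi(k-m)ⱼ V(k-m)ₚ)`
  have hcomp : ∀ p, mFourierCoeff (EuclideanSpace.complexify ∘ Torus.convect u v) k p =
      ∑ j, ∑' m, U m j * ((2 * Real.pi * Complex.I * ((k - m) j : ℤ)) * V (k - m) p) := by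
    intro p
    rw [mFourierCoeff_apply_euclidean hcs.complexify_comp.integrable, hfun p,
      mFourierCoeff_finset_sum
        (f := fun j y => (fun z => ((u z j : ℝ) : ℂ)) y *
          Torus.partialDeriv j (fun z => ((v z p : ℝ) : ℂ)) y)
        _ fun j _ => ((huj j).continuous.mul
          ((hvp p).partialDeriv j).continuous).integrable_unitAddTorus]
    refine Finset.sum_congr rfl fun j _ => ?_
    rw [mFourierCoeff_mul (huj j).continuous (summable_norm_mFourierCoeff_ofReal_apply hu j)
      ((hvp p).partialDeriv j).continuous, lconv_apply]
    refine tsum_congr fun m => ?_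
    rw [← mFourierCoeff_complexify_apply hu.integrable m j,
      mFourierCoeff_partialDeriv (hvp p) j (k - m),
      ← mFourierCoeff_complexify_apply hv.integrable (k - m) p, smul_eq_mul]
  -- the summands are dominated by the convolution majorant (for the exchange of `∑ⱼ` and `∑ₘ`)
  have hterm : ∀ p j m, ‖U m j * ((2 * Real.pi * Complex.I * ((k - m) j : ℤ)) * V (k - m) p)‖ ≤
      2 * Real.pi * (‖U m‖ * (Real.sqrt (freqNormSq (k - m)) * ‖V (k - m)‖)) := by
    intro p j m
    rw [norm_mul, norm_mul]
    have h1 : ‖U m j‖ ≤ ‖U m‖ := PiLp.norm_apply_le _ j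
    have h2 : ‖V (k - m) p‖ ≤ ‖V (k - m)‖ := PiLp.norm_apply_le _ p
    have h3 : ‖(2 * Real.pi * Complex.I * ((k - m) j : ℤ) : ℂ)‖ ≤
        2 * Real.pi * Real.sqrt (freqNormSq (k - m)) := by
      rw [norm_mul, Complex.norm_intCast]
      have : ‖(2 * Real.pi * Complex.I : ℂ)‖ = 2 * Real.pi := by
        simp [abs_of_pos Real.pi_pos]
      rw [this]
      exact mul_le_mul_of_nonneg_left (abs_apply_le_sqrt_freqNormSq (k - m) j) (by positivity)
    calc ‖U m j‖ * (‖(2 * Real.pi * Complex.I * ((k - m) j : ℤ) : ℂ)‖ * ‖V (k - m) p‖)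
        ≤ ‖U m‖ * ((2 * Real.pi * Real.sqrt (freqNormSq (k - m))) * ‖V (k - m)‖) :=
          mul_le_mul h1 (mul_le_mul h3 h2 (norm_nonneg _) (by positivity)) (by positivity)
            (norm_nonneg _)
      _ = 2 * Real.pi * (‖U m‖ * (Real.sqrt (freqNormSq (k - m)) * ‖V (k - m)‖)) := by ring
  have hs' : ∀ p j, Summable fun m =>
      U m j * ((2 * Real.pi * Complex.I * ((k - m) j : ℤ)) * V (k - m) p) := fun p j =>
    Summable.of_norm_bounded (hMs.mul_left _) (hterm p j)
  -- exchange the sums: `𝓕((u·∇)v)ₚ(k) = ∑ₘ ∑ⱼ Uⱼ(m) (2πi(k-m)ⱼ) V(k-m)ₚ`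
  have hcomp' : ∀ p, mFourierCoeff (EuclideanSpace.complexify ∘ Torus.convect u v) k p =
      ∑' m, ∑ j, U m j * ((2 * Real.pi * Complex.I * ((k - m) j : ℤ)) * V (k - m) p) := by
    intro p
    rw [hcomp p]
    exact (Summable.tsum_finsetSum fun j _ => hs' p j).symm
  -- divergence-free: `∑ⱼ mⱼ Uⱼ(m) = 0`, so `∑ⱼ (k - m)ⱼ Uⱼ(m) = ∑ⱼ kⱼ Uⱼ(m)`
  have hdivm : ∀ m, ∑ j, (((k - m) j : ℤ) : ℂ) * U m j = ∑ j, ((k j : ℤ) : ℂ) * U m j := by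
    intro m
    have h0 : ∑ j, ((m j : ℤ) : ℂ) * U m j = 0 := IsDivFree.sum_mul_mFourierCoeff_eq_zero hu hdiv m
    simp only [Pi.sub_apply, Int.cast_sub, sub_mul, Finset.sum_sub_distrib, h0, sub_zero]
  have hS : ∀ p m, ∑ j, U m j * ((2 * Real.pi * Complex.I * ((k - m) j : ℤ)) * V (k - m) p) =
      (2 * Real.pi * Complex.I * V (k - m) p) * ∑ j, ((k j : ℤ) : ℂ) * U m j := by
    intro p m
    rw [← hdivm m, Finset.mul_sum]
    exact Finset.sum_congr rfl fun j _ => by ring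
  -- the bound of each summand: `2π n |k| ‖U m‖ ‖V (k - m)‖`
  have hSle : ∀ p m, ‖∑ j, U m j * ((2 * Real.pi * Complex.I * ((k - m) j : ℤ)) * V (k - m) p)‖ ≤
      2 * Real.pi * ((Fintype.card d : ℝ) * Real.sqrt (freqNormSq k)) * (‖U m‖ * ‖V (k - m)‖) := by
    intro p m
    rw [hS p m]
    refine (norm_mul_le _ _).trans ?_
    have h1 : ‖(2 * Real.pi * Complex.I * V (k - m) p : ℂ)‖ = 2 * Real.pi * ‖V (k - m) p‖ := by
      rw [norm_mul]
      have : ‖(2 * Real.pi * Complex.I : ℂ)‖ = 2 * Real.pi := by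
        simp [abs_of_pos Real.pi_pos]
      rw [this]
    have h2 : ‖∑ j, ((k j : ℤ) : ℂ) * U m j‖ ≤
        (Fintype.card d : ℝ) * Real.sqrt (freqNormSq k) * ‖U m‖ := by
      refine (norm_sum_le _ _).trans ?_
      calc ∑ j, ‖((k j : ℤ) : ℂ) * U m j‖ ≤ ∑ _j : d, Real.sqrt (freqNormSq k) * ‖U m‖ :=
            Finset.sum_le_sum fun j _ => by
              rw [norm_mul, Complex.norm_intCast]
              exact mul_le_mul (abs_apply_le_sqrt_freqNormSq k j) (PiLp.norm_apply_le (U m) j)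
                (norm_nonneg _) (Real.sqrt_nonneg _)
        _ = (Fintype.card d : ℝ) * Real.sqrt (freqNormSq k) * ‖U m‖ := by
            rw [Finset.sum_const, Finset.card_univ, nsmul_eq_mul]
            ring
    rw [h1]
    calc 2 * Real.pi * ‖V (k - m) p‖ * ‖∑ j, ((k j : ℤ) : ℂ) * U m j‖
        ≤ 2 * Real.pi * ‖V (k - m)‖ * ((Fintype.card d : ℝ) * Real.sqrt (freqNormSq k) * ‖U m‖) :=
          mul_le_mul (mul_le_mul_of_nonneg_left (PiLp.norm_apply_le _ p) (by positivity)) h2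
            (norm_nonneg _) (by positivity)
      _ = 2 * Real.pi * ((Fintype.card d : ℝ) * Real.sqrt (freqNormSq k)) * (‖U m‖ * ‖V (k - m)‖) := by
          ring
  -- componentwise bound
  have hp : ∀ p, ‖mFourierCoeff (EuclideanSpace.complexify ∘ Torus.convect u v) k p‖ ≤
      2 * Real.pi * ((Fintype.card d : ℝ) * Real.sqrt (freqNormSq k)) * T := by
    intro p
    rw [hcomp' p]
    have hns : Summable fun m =>
        2 * Real.pi * ((Fintype.card d : ℝ) * Real.sqrt (freqNormSq k)) * (‖U m‖ * ‖V (k - m)‖) :=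
      hTs.mul_left _
    have hns' : Summable fun m =>
        ‖∑ j, U m j * ((2 * Real.pi * Complex.I * ((k - m) j : ℤ)) * V (k - m) p)‖ :=
      hns.of_nonneg_of_le (fun _ => norm_nonneg _) (hSle p)
    calc ‖∑' m, ∑ j, U m j * ((2 * Real.pi * Complex.I * ((k - m) j : ℤ)) * V (k - m) p)‖
        ≤ ∑' m, ‖∑ j, U m j * ((2 * Real.pi * Complex.I * ((k - m) j : ℤ)) * V (k - m) p)‖ :=
          norm_tsum_le_tsum_norm hns'
      _ ≤ ∑' m, 2 * Real.pi * ((Fintype.card d : ℝ) * Real.sqrt (freqNormSq k)) *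
            (‖U m‖ * ‖V (k - m)‖) := hns'.tsum_le_tsum (hSle p) hns
      _ = 2 * Real.pi * ((Fintype.card d : ℝ) * Real.sqrt (freqNormSq k)) * T := by
          rw [tsum_mul_left]
  calc ‖mFourierCoeff (EuclideanSpace.complexify ∘ Torus.convect u v) k‖
      ≤ ∑ p, ‖mFourierCoeff (EuclideanSpace.complexify ∘ Torus.convect u v) k p‖ :=
        norm_le_sum_norm_apply _
    _ ≤ ∑ _p : d, 2 * Real.pi * ((Fintype.card d : ℝ) * Real.sqrt (freqNormSq k)) * T :=
        Finset.sum_le_sum fun p _ => hp p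
    _ = 2 * Real.pi * (Fintype.card d : ℝ) ^ 2 * Real.sqrt (freqNormSq k) * T := by
        rw [Finset.sum_const, Finset.card_univ, nsmul_eq_mul]
        ring

/-! ### §2 The trilinear estimate (3.5) on the lattice -/

omit [DecidableEq d] in
/-- `|k|^s ≤ 2^s (|m|^s + |k − m|^s)` (`s ≥ 0`), in the form
`(freqNormSq k)^{s/2} ≤ 2^s ((freqNormSq m)^{s/2} + (freqNormSq (k − m))^{s/2})`. [folklore] -/
private theorem rpow_freqNormSq_le_two_pow_mul_add {s : ℝ} (hs : 0 ≤ s) (k m : d → ℤ) :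
    freqNormSq k ^ (s / 2) ≤
      (2 : ℝ) ^ s * (freqNormSq m ^ (s / 2) + freqNormSq (k - m) ^ (s / 2)) := by
  classical
  have hk : m + (k - m) = k := by abel
  have h1 : Real.sqrt (freqNormSq k) ≤ Real.sqrt (freqNormSq m) + Real.sqrt (freqNormSq (k - m)) := by
    have h := NSGevrey.sqrt_freqNormSq_add_le m (k - m)
    rwa [hk] at h
  set M : ℝ := max (freqNormSq m) (freqNormSq (k - m)) with hM
  have hM0 : 0 ≤ M := le_max_of_le_left (freqNormSq_nonneg m)
  have h2 : freqNormSq k ≤ 4 * M := by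
    have ha : Real.sqrt (freqNormSq m) ≤ Real.sqrt M := Real.sqrt_le_sqrt (le_max_left _ _)
    have hb : Real.sqrt (freqNormSq (k - m)) ≤ Real.sqrt M := Real.sqrt_le_sqrt (le_max_right _ _)
    have h3 : Real.sqrt (freqNormSq k) ≤ 2 * Real.sqrt M := by linarith
    calc freqNormSq k = Real.sqrt (freqNormSq k) ^ 2 := (Real.sq_sqrt (freqNormSq_nonneg k)).symm
      _ ≤ (2 * Real.sqrt M) ^ 2 := pow_le_pow_left₀ (Real.sqrt_nonneg _) h3 2
      _ = 4 * M := by rw [mul_pow, Real.sq_sqrt hM0]; norm_num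
  have hs2 : 0 ≤ s / 2 := by linarith
  calc freqNormSq k ^ (s / 2) ≤ (4 * M) ^ (s / 2) := Real.rpow_le_rpow (freqNormSq_nonneg k) h2 hs2
    _ = (2 : ℝ) ^ s * M ^ (s / 2) := by
        rw [Real.mul_rpow (by norm_num) hM0, show (4 : ℝ) = (2 : ℝ) ^ (2 : ℝ) by norm_num,
          ← Real.rpow_mul (by norm_num)]
        congr 2
        ring
    _ ≤ (2 : ℝ) ^ s * (freqNormSq m ^ (s / 2) + freqNormSq (k - m) ^ (s / 2)) := by
        refine mul_le_mul_of_nonneg_left ?_ (by positivity)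
        rcases le_total (freqNormSq m) (freqNormSq (k - m)) with h | h
        · rw [hM, max_eq_right h]
          linarith [Real.rpow_nonneg (freqNormSq_nonneg m) (s / 2)]
        · rw [hM, max_eq_left h]
          linarith [Real.rpow_nonneg (freqNormSq_nonneg (k - m)) (s / 2)]

/-- **Robinson–Sadowski–Silva (3.5) on the lattice**: "`|(B(u,u), A^s u)| ≤ c ‖u‖_s ‖u‖_{s+1} ‖u‖_F`"
(J. Math. Phys. 53 (2012) 115618, (3.5), `‖u‖_F = ∑_k |û(k)|`, `‖u‖_s² = ∑_k |k|^{2s}|û(k)|²`),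
in the following truncated form on the unit torus `T^n` (`n = card d`): for a smooth
divergence-free field `u`, `s ≥ 0` and every finite set `K` of frequencies,
`∑_{k∈K} |k|^{2s} ‖û(k)‖ ‖𝓕((u·∇)u)(k)‖ ≤ 4π n² 2^s (∑_m ‖û(m)‖) (∑_m |m|^{2s}‖û(m)‖²)^{1/2} (∑_{k∈K} |k|^{2s+2}‖û(k)‖²)^{1/2}`
(`|k|^{2s} = (freqNormSq k)^s`, `û = 𝓕(complexify ∘ u)`; the last factor is the `Ḣ^{s+1}`
seminorm truncated to `K`, the form used in differential inequalities for truncated Sobolev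
sums; `K = ` everything recovers (3.5) with `c = 4π n² 2^s`). Proof as in the paper: the
divergence form `NSSobolev.norm_mFourierCoeff_convect_le_of_isDivFree`, `|k|^{2s+1} = |k|^{s+1}|k|^s`,
`|k|^s ≤ 2^s(|m|^s + |k−m|^s)`, and Young's inequality for lattice convolutions
(`NSGevrey.sum_mul_tsum_mul_le`). [cite: RobinsonSadowskiSilva2012, §III (3.5)] -/
theorem sum_rpow_mul_norm_mul_norm_convect_le (hu : IsSmooth u) (hdiv : IsDivFree u) {s : ℝ}
    (hs : 0 ≤ s) (K : Finset (d → ℤ)) :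
    ∑ k ∈ K, freqNormSq k ^ s * ‖mFourierCoeff (EuclideanSpace.complexify ∘ u) k‖ *
        ‖mFourierCoeff (EuclideanSpace.complexify ∘ Torus.convect u u) k‖ ≤
      4 * Real.pi * (Fintype.card d : ℝ) ^ 2 * (2 : ℝ) ^ s *
        (∑' m : d → ℤ, ‖mFourierCoeff (EuclideanSpace.complexify ∘ u) m‖) *
        Real.sqrt (∑' m : d → ℤ,
          freqNormSq m ^ s * ‖mFourierCoeff (EuclideanSpace.complexify ∘ u) m‖ ^ 2) *
        Real.sqrt (∑ k ∈ K,
          freqNormSq k ^ (s + 1) * ‖mFourierCoeff (EuclideanSpace.complexify ∘ u) k‖ ^ 2) := by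
  classical
  set c : (d → ℤ) → EuclideanSpace ℂ d := fun m => mFourierCoeff (EuclideanSpace.complexify ∘ u) m
    with hc
  set a : (d → ℤ) → ℝ := fun m => ‖c m‖ with ha
  set b : (d → ℤ) → ℝ := fun m => freqNormSq m ^ (s / 2) * a m with hb
  set γ : (d → ℤ) → ℝ := fun k => freqNormSq k ^ ((s + 1) / 2) * a k with hγ
  have ha0 : ∀ m, 0 ≤ a m := fun m => norm_nonneg _
  have hb0 : ∀ m, 0 ≤ b m := fun m => mul_nonneg (Real.rpow_nonneg (freqNormSq_nonneg m) _) (ha0 m)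
  have hγ0 : ∀ k, 0 ≤ γ k := fun k => mul_nonneg (Real.rpow_nonneg (freqNormSq_nonneg k) _) (ha0 k)
  have hRD := hu.complexify_comp.rapidDecay_mFourierCoeff
  have has : Summable a := hRD.summable_norm
  -- `b ∈ ℓ¹`: `|m|^s ≤ (1 + |m|²)^N`
  obtain ⟨N, hN⟩ := exists_nat_ge (s / 2)
  have hbs : Summable b := by
    refine (hRD N).of_nonneg_of_le hb0 fun m => ?_
    refine mul_le_mul_of_nonneg_right ?_ (ha0 m)
    calc freqNormSq m ^ (s / 2) ≤ (1 + freqNormSq m) ^ (s / 2) :=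
          Real.rpow_le_rpow (freqNormSq_nonneg m) (by linarith) (by linarith)
      _ ≤ (1 + freqNormSq m) ^ (N : ℝ) :=
          Real.rpow_le_rpow_of_exponent_le (by linarith [freqNormSq_nonneg m]) hN
      _ = (1 + freqNormSq m) ^ N := Real.rpow_natCast _ _
  -- `b² = |m|^{2s} a²`, `γ² = |k|^{2s+2} a²`
  have hsq : ∀ (t : ℝ) (m : d → ℤ), (freqNormSq m ^ (t / 2)) ^ 2 = freqNormSq m ^ t := fun t m => by
    rw [← Real.rpow_two, ← Real.rpow_mul (freqNormSq_nonneg m)]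
    congr 1
    ring
  have hb2eq : ∀ m, b m ^ 2 = freqNormSq m ^ s * ‖c m‖ ^ 2 := fun m => by
    simp only [hb, ha, mul_pow, hsq]
  have hγ2eq : ∀ k, γ k ^ 2 = freqNormSq k ^ (s + 1) * ‖c k‖ ^ 2 := fun k => by
    simp only [hγ, ha, mul_pow, hsq]
  have hb2 : Summable fun m => b m ^ 2 :=
    (hu.summable_freqNormSq_rpow_mul_norm_sq hs).congr fun m => (hb2eq m).symm
  have haA : ∀ l, a l ≤ ∑' m, a m := fun l => has.le_tsum l fun j _ => ha0 j
  have hbB : ∀ l, b l ≤ ∑' m, b m := fun l => hbs.le_tsum l fun j _ => hb0 j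
  have hconv : ∀ k, Summable fun m => a m * a (k - m) := fun k => summable_norm_mul_norm_sub hu hu k
  have hba : ∀ k, Summable fun m => b m * a (k - m) := fun k =>
    (hbs.mul_right (∑' m, a m)).of_nonneg_of_le (fun m => mul_nonneg (hb0 m) (ha0 _)) fun m =>
      mul_le_mul_of_nonneg_left (haA _) (hb0 m)
  have hab : ∀ k, Summable fun m => a m * b (k - m) := fun k =>
    (has.mul_right (∑' m, b m)).of_nonneg_of_le (fun m => mul_nonneg (ha0 m) (hb0 _)) fun m =>
      mul_le_mul_of_nonneg_left (hbB _) (ha0 m)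
  set C₁ : ℝ := 2 * Real.pi * (Fintype.card d : ℝ) ^ 2 with hC₁
  have hC₁0 : 0 ≤ C₁ := by positivity
  -- ### the bound of each summand
  have hTle : ∀ k ∈ K, freqNormSq k ^ s * a k *
      ‖mFourierCoeff (EuclideanSpace.complexify ∘ Torus.convect u u) k‖ ≤
      C₁ * (2 : ℝ) ^ s * (γ k * ((∑' m, b m * a (k - m)) + ∑' m, a m * b (k - m))) := by
    intro k _
    have h1 := norm_mFourierCoeff_convect_le_of_isDivFree hu hdiv hu k
    -- `|k|^{s} ∑ₘ aₘ a_{k−m} ≤ 2^s (∑ₘ bₘ a_{k−m} + ∑ₘ aₘ b_{k−m})`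
    have h2 : freqNormSq k ^ (s / 2) * ∑' m, a m * a (k - m) ≤
        (2 : ℝ) ^ s * ((∑' m, b m * a (k - m)) + ∑' m, a m * b (k - m)) := by
      rw [← (hba k).tsum_add (hab k), ← tsum_mul_left, ← tsum_mul_left]
      refine Summable.tsum_le_tsum (fun m => ?_) ((hconv k).mul_left _)
        (((hba k).add (hab k)).mul_left _)
      calc freqNormSq k ^ (s / 2) * (a m * a (k - m))
          ≤ (2 : ℝ) ^ s * (freqNormSq m ^ (s / 2) + freqNormSq (k - m) ^ (s / 2)) *
              (a m * a (k - m)) :=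
            mul_le_mul_of_nonneg_right (rpow_freqNormSq_le_two_pow_mul_add hs k m)
              (mul_nonneg (ha0 _) (ha0 _))
        _ = (2 : ℝ) ^ s * (b m * a (k - m) + a m * b (k - m)) := by
            simp only [hb]
            ring
    -- `|k|^{2s} · |k| = |k|^{s+1} · |k|^{s}`
    have hx0 := freqNormSq_nonneg k
    have e : freqNormSq k ^ s * Real.sqrt (freqNormSq k) =
        freqNormSq k ^ ((s + 1) / 2) * freqNormSq k ^ (s / 2) := by
      rw [Real.sqrt_eq_rpow, ← Real.rpow_add' hx0 (by linarith : (0 : ℝ) < s + 1 / 2).ne',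
        ← Real.rpow_add' hx0 (by linarith : (0 : ℝ) < (s + 1) / 2 + s / 2).ne']
      congr 1
      ring
    calc freqNormSq k ^ s * a k * ‖mFourierCoeff (EuclideanSpace.complexify ∘ Torus.convect u u) k‖
        ≤ freqNormSq k ^ s * a k * (C₁ * Real.sqrt (freqNormSq k) * ∑' m, a m * a (k - m)) :=
          mul_le_mul_of_nonneg_left h1 (mul_nonneg (Real.rpow_nonneg hx0 _) (ha0 k))
      _ = C₁ * (γ k * (freqNormSq k ^ (s / 2) * ∑' m, a m * a (k - m))) := by
          simp only [hγ]
          calc freqNormSq k ^ s * a k * (C₁ * Real.sqrt (freqNormSq k) * ∑' m, a m * a (k - m))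
              = C₁ * a k * (∑' m, a m * a (k - m)) *
                  (freqNormSq k ^ s * Real.sqrt (freqNormSq k)) := by ring
            _ = C₁ * (freqNormSq k ^ ((s + 1) / 2) * a k *
                  (freqNormSq k ^ (s / 2) * ∑' m, a m * a (k - m))) := by rw [e]; ring
      _ ≤ C₁ * (γ k * ((2 : ℝ) ^ s * ((∑' m, b m * a (k - m)) + ∑' m, a m * b (k - m)))) :=
          mul_le_mul_of_nonneg_left (mul_le_mul_of_nonneg_left h2 (hγ0 k)) hC₁0
      _ = C₁ * (2 : ℝ) ^ s * (γ k * ((∑' m, b m * a (k - m)) + ∑' m, a m * b (k - m))) := by ring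
  -- ### summation over `K` and Young's inequality for the two lattice convolutions
  have hre : ∀ k, ∑' m, b m * a (k - m) = ∑' j, a j * b (k - j) := fun k => by
    rw [← (Equiv.subLeft k).tsum_eq (fun m => b m * a (k - m))]
    refine tsum_congr fun j => ?_
    simp only [Equiv.subLeft_apply, sub_sub_cancel]
    ring
  have hY := NSGevrey.sum_mul_tsum_mul_le K ha0 hb0 hγ0 has hb2
  have hsumK : ∑ k ∈ K, freqNormSq k ^ s * a k *
      ‖mFourierCoeff (EuclideanSpace.complexify ∘ Torus.convect u u) k‖ ≤
      C₁ * (2 : ℝ) ^ s * (2 * ((∑' j, a j) * Real.sqrt (∑' j, b j ^ 2) *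
        Real.sqrt (∑ k ∈ K, γ k ^ 2))) := by
    calc ∑ k ∈ K, freqNormSq k ^ s * a k *
          ‖mFourierCoeff (EuclideanSpace.complexify ∘ Torus.convect u u) k‖
        ≤ ∑ k ∈ K, C₁ * (2 : ℝ) ^ s * (γ k * ((∑' m, b m * a (k - m)) + ∑' m, a m * b (k - m))) :=
          Finset.sum_le_sum hTle
      _ = C₁ * (2 : ℝ) ^ s * (∑ k ∈ K, γ k * ∑' j, a j * b (k - j) +
            ∑ k ∈ K, γ k * ∑' j, a j * b (k - j)) := by
          rw [← Finset.mul_sum, ← Finset.sum_add_distrib]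
          congr 1
          exact Finset.sum_congr rfl fun k _ => by rw [hre k]; ring
      _ ≤ C₁ * (2 : ℝ) ^ s * (2 * ((∑' j, a j) * Real.sqrt (∑' j, b j ^ 2) *
            Real.sqrt (∑ k ∈ K, γ k ^ 2))) := by
          refine mul_le_mul_of_nonneg_left ?_ (by positivity)
          linarith [hY]
  have hb2sum : ∑' j, b j ^ 2 = ∑' m, freqNormSq m ^ s * ‖c m‖ ^ 2 := tsum_congr hb2eq
  have hγ2sum : ∑ k ∈ K, γ k ^ 2 = ∑ k ∈ K, freqNormSq k ^ (s + 1) * ‖c k‖ ^ 2 :=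
    Finset.sum_congr rfl fun k _ => hγ2eq k
  rw [hb2sum, hγ2sum] at hsumK
  refine hsumK.trans (le_of_eq ?_)
  simp only [hC₁, ha, hc]
  ring

end NSSobolev

end Literature.Analysis.FluidPDE

end
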